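import Literature.NumberTheory.PAdicHodge.LabelledWeightsInducedDeRham
import Literature.NumberTheory.GaloisRepresentations.LabelledWeightsFiniteDim
import HarnessLib

/-!
# Discharge of the named fact `LabelledWeightsInduceSchema`
# (Patrikis 2019, Lemma 7.2.1: `HT_{(v,τ)}(Ind_{Γ_E}^{Γ_K} W) = Σ_i HT_{(w_i,σ_i)}(W)`, THE pinned data)

Topic `NumberTheory/PAdicHodge`.  PROOF FILE (theorems only: no definition, no named fact, no
instance; D-0026), a second sibling of `FontainePstInductionSchemata` (the first,
`FontainePstInductionSchemataProofs`, discharges `IsDeRhamFramedInduceSchema`).  It proves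

* `labelledHodgeTateWeightsAtLabel_induce` — for number fields `K ⊆ E` with `[E : K] = d`, EVERY
  continuous framed `W : Γ_E → GL_n(ℚ̄_ℓ)`, a place `v ∣ ℓ` of `K` and a pinned label `τ` at `v`:
  there are `d` labels `(w_i, σ_i)` of `E` above `(v, τ)` with pairwise distinct global embeddings
  and `HT_{(v,τ)}(Ind_{Γ_E}^{Γ_K} W) = Σ_i HT_{(w_i,σ_i)}(W)`;
* `LabelledWeightsInduceSchema_holds : LabelledWeightsInduceSchema` — the named fact of
  `FontainePstInductionSchemata` (its three clauses verbatim), now a theorem.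

The argument is that of `LabelledWeightsInducedDeRham` (Galois closure `L` of `E/K`; `(Ind W)|_{Γ_L}`
is block diagonal with blocks `W(t_i) (W|_{Γ_L,ε_i}) W(t_i)⁻¹` along `K`-linear, pairwise distinct
embeddings `ε_i : E → L`; label-wise restriction to a label `(u, υ)` of `L` above `(v, τ)`;
additivity of labelled weights over the blocks; frame invariance; label-wise restriction along each
`ε_i`), with the one input that needed de Rham-ness there — finite-dimensionality over `ℚ̄_ℓ` of the
label components `D_υ` of the blocks, required by the additivity
`PeriodRingData.labelledHodgeTateWeights_blockDiagonal` — now supplied unconditionally by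
`fontainePst_finiteDimensional_labelD` (`LabelledWeightsFiniteDim`: a finite `ℚ_ℓ`-model exists by
Baire category on the compact `Γ_{L_u}`, accepted `exists_hasQlModel_holds`, and over a finite
coefficient field `D_υ` is finite-dimensional by Fontaine's inequality).

## References

* [Patrikis2019] S. Patrikis, *Variations on a theorem of Tate*, Mem. AMS 258 (2019)
  (arXiv:1207.6724), §2.7.1 and Lemma 7.2.1 with its proof.
* [FontaineAsterisque223III] J.-M. Fontaine, *Représentations p-adiques semi-stables*, Astérisque
  223 (1994), Exp. III Prop. 1.4.2, Prop. 1.5.2 and §3.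
* [BrinonConrad2009] O. Brinon, B. Conrad, *CMI Summer School notes on p-adic Hodge theory*
  (2009), Prop. 6.3.8.
* [BuzzardGeeLMS2014] K. Buzzard, T. Gee, *The conjectural connections between automorphic
  representations and Galois representations* (2014), footnote to Conj. 3.2.1 (finite models).
* [NeukirchANT1999] J. Neukirch, *Algebraic Number Theory* (1999), Ch. II (8.1)–(8.3).
* [SerreAbelianLadic1968] J.-P. Serre, *Abelian ℓ-adic representations and elliptic curves* (1968),
  Ch. I §2.1, §2.3.
-/

noncomputable section

open scoped NumberField MatrixGroups Matrix
open NumberField IsDedekindDomain Field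
open Literature.NumberTheory.Automorphic Literature.NumberTheory.PAdicHodge

namespace Literature.NumberTheory.PAdicHodge

open Literature.NumberTheory.GaloisRepresentations

/-- **`HT_{(v,τ)}(Ind_{Γ_E}^{Γ_K} W) = Σ_i HT_{(w_i,σ_i)}(W)` for EVERY continuous `W`, THE pinned
Fontaine data** (Patrikis 2019, Lemma 7.2.1 and its proof): for number fields `K ⊆ E` with
`[E : K] = d`, a framed `W : Γ_E → GL_n(ℚ̄_ℓ)`, a place `v ∣ ℓ` of `K` and a pinned label `τ` at `v`,
there are `d` labels `(w_i, σ_i)` of `E` above `(v, τ)` with pairwise distinct global embeddings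
such that `HT_{(v,τ)}(Ind W) = Σ_i HT_{(w_i,σ_i)}(W)`.  Same proof as
`labelledHodgeTateWeightsAtLabel_induce_of_isDeRhamFramed`, the finite-dimensionality of the label
components of the blocks being `fontainePst_finiteDimensional_labelD` (no de Rham hypothesis).
[cite: Patrikis2019, §2.7.1 and Lemma 7.2.1 (numbering of arXiv:1207.6724)]
[cite: FontaineAsterisque223III, Exp. III Prop. 1.4.2, Prop. 1.5.2 and §3] [cite: BrinonConrad2009, Prop. 6.3.8]
[cite: BuzzardGeeLMS2014, footnote to Conj. 3.2.1] [cite: NeukirchANT1999, Ch. II (8.1)–(8.3)] -/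
theorem labelledHodgeTateWeightsAtLabel_induce (K E : Type) [Field K]
    [NumberField K] [Field E] [NumberField E] [Algebra K E] (d : ℕ) (hd : Module.finrank K E = d)
    (ℓ : ℕ) [Fact ℓ.Prime] (n : ℕ) (W : FramedGaloisRep E (PadicAlgCl ℓ) n)
    (v : HeightOneSpectrum (𝓞 K)) (hv : ((ℓ : ℕ) : 𝓞 K) ∈ v.asIdeal) (τ : PinnedLabel ℓ v hv) :
    ∃ (w : Fin d → HeightOneSpectrum (𝓞 E)) (hw : ∀ i, ((ℓ : ℕ) : 𝓞 E) ∈ (w i).asIdeal)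
      (σ : ∀ i, PinnedLabel ℓ (w i) (hw i)),
      (∀ i, (σ i).emb.comp (algebraMap K E) = τ.emb) ∧
      (Function.Injective fun i => (σ i).emb) ∧
      labelledHodgeTateWeightsAtLabel (W.induce K hd) v hv τ =
        ∑ i, labelledHodgeTateWeightsAtLabel W (w i) (hw i) (σ i) := by
  classical
  -- the Galois closure of `E/K` inside `K̄`
  let Lf : IntermediateField K (AlgebraicClosure K) :=
    IntermediateField.normalClosure K E (AlgebraicClosure K)
  haveI : NumberField Lf := NumberField.of_module_finite K Lf
  -- every conjugate of `ε(E)` lies in `λ(L) = L`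
  have hcl : ∀ (r : absoluteGaloisGroup K) (x : E),
      ∃ y : Lf, absEmbedding K Lf y = r • absEmbedding K E x := by
    intro r x
    have hx : absEmbedding K E x ∈ Lf := (absEmbedding K E).fieldRange_le_normalClosure ⟨x, rfl⟩
    have hrx : r • absEmbedding K E x ∈ Lf := by
      refine (IntermediateField.normal_iff_forall_map_le'.1 (normalClosure.normal K E _)
        (absoluteGaloisGroup.toAlgEquiv K r)) ?_
      exact (IntermediateField.mem_map _).2 ⟨_, hx, rfl⟩
    rw [← AlgHom.fieldRange_of_normal (absEmbedding K Lf)] at hrx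
    exact AlgHom.mem_fieldRange.1 hrx
  -- the embeddings `εᵢ : E → L` (`λ ∘ εᵢ = rᵢ ∘ ε`) and the frame changes `tᵢ` at the coset
  -- representatives `rᵢ`
  choose ε hε using fun i : Fin d =>
    exists_ringHom_absEmbedding_eq_smul (L := Lf) (absGaloisCosetRep K E hd i) (hcl _)
  have ht₀ : ∀ i : Fin d, ∃ t : absoluteGaloisGroup E, ∀ σ : absoluteGaloisGroup Lf,
      (absGaloisCosetRep K E hd i)⁻¹ * absGaloisRestrict K Lf σ * absGaloisCosetRep K E hd i =
        absGaloisRestrict K E (t * @absGaloisRestrict E Lf _ _ (ε i).toAlgebra σ * t⁻¹) := fun i => by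
    letI : Algebra E Lf := (ε i).toAlgebra
    exact exists_conj_absGaloisRestrict_eq_of_absEmbedding_eq (K := K) (E := E) (L := Lf)
      (absGaloisCosetRep K E hd i) (hε i)
  choose t ht using ht₀
  -- the blocks `Vᵢ = W(tᵢ) (W|_{Γ_L, εᵢ}) W(tᵢ)⁻¹`
  let V : Fin d → FramedGaloisRep Lf (PadicAlgCl ℓ) n := fun i =>
    FramedRep.conj (W (t i)) (W.comp (@absGaloisRestrict E Lf _ _ (ε i).toAlgebra))
  have hV : ∀ (i : Fin d) (σ : absoluteGaloisGroup Lf),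
      V i σ = W (t i * @absGaloisRestrict E Lf _ _ (ε i).toAlgebra σ * (t i)⁻¹) := fun i σ => by
    change FramedRep.conj (W (t i)) (W.comp (@absGaloisRestrict E Lf _ _ (ε i).toAlgebra)) σ = _
    rw [FramedRep.conj_apply, map_mul, map_mul, map_inv]
    rfl
  -- `(Ind W)|_{Γ_L}` is block diagonal with blocks `Vᵢ`, at every place `u` of `L`
  have hshape : ∀ (u : HeightOneSpectrum (𝓞 Lf)) (g : absoluteGaloisGroup (u.adicCompletion Lf)),
      (((((W.induce K hd).restrictField Lf).toLocal u) g : GL (Fin (d * n)) (PadicAlgCl ℓ)) :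
          Matrix (Fin (d * n)) (Fin (d * n)) (PadicAlgCl ℓ)) =
        Matrix.reindex finProdFinEquiv finProdFinEquiv
          (Matrix.comp (Fin d) (Fin d) (Fin n) (Fin n) (PadicAlgCl ℓ)
            (Matrix.diagonal fun i =>
              (((V i).toLocal u g : GL (Fin n) (PadicAlgCl ℓ)) : Matrix (Fin n) (Fin n) (PadicAlgCl ℓ)))) := by
    intro u g
    set σ := absGaloisRestrict Lf (u.adicCompletion Lf) g with hσ
    have hmem : ∀ i : Fin d, (absGaloisCosetRep K E hd i)⁻¹ * absGaloisRestrict K Lf σ *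
        absGaloisCosetRep K E hd i ∈ (absGaloisRestrict K E).range := fun i => ⟨_, (ht i σ).symm⟩
    have hblocks : (fun i : Fin d => dotExtend (absGaloisRestrict K E).toMonoidHom
        (FramedRep.toMatrixHom W)
        ((absGaloisCosetRep K E hd i)⁻¹ * absGaloisRestrict K Lf σ * absGaloisCosetRep K E hd i)) =
        fun i => (((V i).toLocal u g : GL (Fin n) (PadicAlgCl ℓ)) :
          Matrix (Fin n) (Fin n) (PadicAlgCl ℓ)) := by
      funext i
      rw [FramedGaloisRep.dotExtend_eq_of_eq_absGaloisRestrict K W (ht i σ), FramedGaloisRep.toLocal_apply,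
        ← hσ, hV]
    rw [FramedGaloisRep.toLocal_apply, ← hσ, FramedGaloisRep.restrictField_apply,
      FramedGaloisRep.induce_apply_coe_of_forall_conj_mem K hd W _ hmem, hblocks]
  -- the `εᵢ` are `K`-linear and pairwise distinct
  have hεK : ∀ i, (ε i).comp (algebraMap K E) = algebraMap K Lf := fun i =>
    ringHom_comp_algebraMap_of_absEmbedding_eq_smul _ _ (hε i)
  have hεinj : Function.Injective ε := by
    intro i j hij
    have hmem : (absGaloisCosetRep K E hd j)⁻¹ * absGaloisCosetRep K E hd i ∈
        (absGaloisRestrict K E).range :=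
      inv_mul_mem_range_absGaloisRestrict_of_absEmbedding_eq_smul _ _ _ _ (hε i) (hε j) hij
    have hq : (absGaloisCosetRep K E hd j : absoluteGaloisGroup K ⧸ (absGaloisRestrict K E).range) =
        (absGaloisCosetRep K E hd i : absoluteGaloisGroup K ⧸ (absGaloisRestrict K E).range) :=
      QuotientGroup.eq.mpr hmem
    exact ((absGaloisCosetRep_bijective K E hd).1 hq).symm
  -- a label `(u, υ)` of `L` above `(v, τ)`
  have hLpos : 0 < Module.finrank K Lf := Module.finrank_pos
  obtain ⟨uL, huL, υL, hυL, -, -, -⟩ :=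
    PinnedLabel.exists_labels_above (K := K) (E := Lf) (ℓ := ℓ) rfl τ
  set u : HeightOneSpectrum (𝓞 Lf) := uL ⟨0, hLpos⟩ with hu_def
  have hu : ((ℓ : ℕ) : 𝓞 Lf) ∈ u.asIdeal := huL ⟨0, hLpos⟩
  set υ : PinnedLabel ℓ u hu := υL ⟨0, hLpos⟩ with hυ_def
  have hυ : υ.emb.comp (algebraMap K Lf) = τ.emb := hυL ⟨0, hLpos⟩
  haveI := LocalField.charZero_adicCompletion u
  -- the label components of the blocks are finite-dimensional over `ℚ̄_ℓ` (finite model by Baire,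
  -- Fontaine's inequality on the model; no de Rham hypothesis)
  have hfin : ∀ i, letI := (fontainePstAdicCompletion u ℓ hu).algebra
      FiniteDimensional (PadicAlgCl ℓ) ((fontainePstAdicCompletion u ℓ hu).𝔅.labelD
        (FramedRep.toContinuousRep ((V i).toLocal u)) υ.toHom) := fun i => by
    letI := (fontainePstAdicCompletion u ℓ hu).algebra
    exact fontainePst_finiteDimensional_labelD
      (LocalField.valuation_adicCompletion_natCast_lt_one u ℓ hu) ((V i).toLocal u) υ
  -- (1) restriction to `Γ_L`, label by label:  `HT_{(v,τ)}(Ind W) = HT_{(u,υ)}((Ind W)|_{Γ_L})`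
  have h1 : labelledHodgeTateWeightsAtLabel (W.induce K hd) v hv τ =
      labelledHodgeTateWeightsAtLabel ((W.induce K hd).restrictField Lf) u hu υ :=
    (labelledHodgeTateWeightsAtLabel_restrictField_of_emb_comp_eq (W.induce K hd) τ υ hυ).symm
  -- (2) additivity over the blocks
  have h2 : labelledHodgeTateWeightsAtLabel ((W.induce K hd).restrictField Lf) u hu υ =
      ∑ i, (letI := (fontainePstAdicCompletion u ℓ hu).algebra
        (fontainePstAdicCompletion u ℓ hu).𝔅.labelledHodgeTateWeights
          (FramedRep.toContinuousRep ((V i).toLocal u)) υ.toHom) := by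
    letI := (fontainePstAdicCompletion u ℓ hu).algebra
    dsimp only [labelledHodgeTateWeightsAtLabel]
    rw [FramedGaloisRep.labelledHodgeTateWeightsAt_def]
    exact (fontainePstAdicCompletion u ℓ hu).𝔅.labelledHodgeTateWeights_blockDiagonal finProdFinEquiv
      (((W.induce K hd).restrictField Lf).toLocal u) (fun i => (V i).toLocal u) (hshape u) υ.toHom hfin
  -- (3) each block: frame invariance and label-wise restriction along `εᵢ`
  have h3 : ∀ i, ∃ (w : HeightOneSpectrum (𝓞 E)) (hw : ((ℓ : ℕ) : 𝓞 E) ∈ w.asIdeal)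
      (σ : PinnedLabel ℓ w hw), σ.emb = υ.emb.comp (ε i) ∧
      (letI := (fontainePstAdicCompletion u ℓ hu).algebra
       (fontainePstAdicCompletion u ℓ hu).𝔅.labelledHodgeTateWeights
         (FramedRep.toContinuousRep ((V i).toLocal u)) υ.toHom) =
        labelledHodgeTateWeightsAtLabel W w hw σ := fun i => by
    letI : Algebra E Lf := (ε i).toAlgebra
    refine ⟨u.under (𝓞 E), natCast_mem_under (F := E) hu, υ.below E, PinnedLabel.emb_below E υ, ?_⟩
    rw [← labelledHodgeTateWeightsAtLabel_restrictField_below W u hu υ]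
    letI := (fontainePstAdicCompletion u ℓ hu).algebra
    dsimp only [labelledHodgeTateWeightsAtLabel]
    rw [FramedGaloisRep.labelledHodgeTateWeightsAt_def]
    change (fontainePstAdicCompletion u ℓ hu).𝔅.labelledHodgeTateWeights (FramedRep.toContinuousRep
      ((FramedRep.conj (W (t i)) (W.restrictField Lf)).comp
        (absGaloisRestrict Lf (u.adicCompletion Lf)))) υ.toHom = _
    rw [FramedRep.conj_comp]
    exact PstWeilDeligneData.labelledHodgeTateWeights_conj_eq _ (W (t i)) _ υ.toHom
  choose w hw σ hσε hσHT using h3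
  refine ⟨w, hw, σ, fun i => ?_, fun i j hij => hεinj ?_, ?_⟩
  · -- above `(v, τ)`
    rw [hσε, RingHom.comp_assoc, hεK, hυ]
  · -- pairwise distinct embeddings
    have hij' : υ.emb.comp (ε i) = υ.emb.comp (ε j) := by
      have := hij
      dsimp only at this
      rwa [hσε, hσε] at this
    exact RingHom.ext fun x => υ.emb.injective (by
      simpa only [RingHom.comp_apply] using congrArg (fun f : E →+* PadicAlgCl ℓ => f x) hij')
  · -- the formula
    rw [h1, h2]
    exact Finset.sum_congr rfl fun i _ => hσHT i


/-- **The named fact `LabelledWeightsInduceSchema` holds** (Patrikis 2019, Lemma 7.2.1 for THE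
pinned Fontaine data: the labels of `E` above `(v, τ)` and the induction formula for labelled
Hodge–Tate weights), by `labelledHodgeTateWeightsAtLabel_induce`.
[cite: Patrikis2019, Lemma 7.2.1 (§7.2; arXiv:1207.6724 p. 38) and p. 64]
[cite: SerreAbelianLadic1968, Ch. I §2.3] -/
theorem LabelledWeightsInduceSchema_holds : LabelledWeightsInduceSchema := by
  intro K E _ _ _ _ _ d hd ℓ _ n W v hv τ
  exact labelledHodgeTateWeightsAtLabel_induce K E d hd ℓ n W v hv τ

end Literature.NumberTheory.PAdicHodge

end
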